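import Summits.BirchSwinnertonDyer.BirchSwinnertonDyer.Theorems.AlignedTransportAtTwoMainConjectureOfRankZeroBSDAtTwoNarrowCubicNamedInputDiscSign
import Summits.BirchSwinnertonDyer.BirchSwinnertonDyer.Theorems.AlignedTransportAtTwoMainConjectureOfRankZeroBSDAtTwoCubicPrimesOfEmbeddings
import HarnessLib

/-!
# Route `AlignedTransportAtTwo`, crux C2 `MainConjectureOfRankZeroBSDAtTwo` (stmt-BirchSwinnertonDyer-22298):
# THE DYADIC NAMED INPUT — the named hypothesis of C2 may be restricted to the non-cyclic cubic fields that EMBED INTO `ℚ₂`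
# (the W-free local class of the cell's cubic `2`-torsion fields: good ORDINARY reduction at `2` ⟹ an odd-unit root of `c_W` in `ℤ₂`)

HONEST FRAMING. WIDTH-5 attached prover seat `bsd-line-att-p4` g34 on line `birth` of the lead `bsd-line-att-p2` (WAKE-only); `--supports`
stmt-BirchSwinnertonDyer-22298, closes nothing; BSD is NOT proved; crux C2, its verdict «blocked-on `Rank1Residual.GreenbergMuConjectureIrreducible`»
and every registered stub (P / T / Kμ / LimDoor / MuIneqʳ / PFμ⁺ of `Lines/birth.lean` v9) untouched. THEOREMS ONLY (no `def`, no named fact, no `sorry`).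
Every door is CONDITIONAL on displayed named print facts (PRINT⁵ = Kato 17.4 (1)(2) at `2` `h17`, Greenberg 1999 Thm. 4.1 `hGr`, period unit `hper`,
modularity `hmod`, GZK `hGZK`) and on the registered stub MuIneqʳ VERBATIM (`hI`). The dyadic narrow `μ₂⁺ = 0` hypothesis below is an OPEN instance of
Iwasawa's `μ`-conjecture / of Greenberg's conjecture in Kida's narrow form for non-abelian fields; NOTHING is asserted about it.

WHY (g33 successor (b): «the restriction class of the named input»). g33's `…NarrowCubicNamedInput.crux_of_forall_nonGalois_cubicField_narrowClassicalMu`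
derives C2 from ONE W-free binder over ALL non-cyclic cubic number fields. But the cell (good ORDINARY at `2`) only ever produces cubic fields of a proper
LOCAL sub-class: by att-p5 g11/g26 (`…KilfordStratum.exists_padicInt_root_of_isOrdinaryAt_two`, Hensel on `c_W ≡ u²(u+1) (mod 2)`) the `u`-cubic of a
good-ordinary curve has a root in `ℤ₂`, so every cubic field containing a root of `c_W` EMBEDS INTO `ℚ₂` (equivalently: has a prime above `2` with
`e = f = 1`; in particular `2` is neither inert nor totally ramified in it — the supersingular-at-`2` signature never occurs). This file records the
W-free consequence for the planner's filing (BC5 «state the weakest sufficient input»):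

* §1 `exists_algHom_padic_two_of_root` — **`W` globally minimal, good ordinary at `2`, `W(ℚ)[2] = 0`, `F` a cubic number field containing a root `e` of
  `c_W` ⟹ there is a `ℚ`-algebra map `σ : F → ℚ₂` with `σ e` an odd `2`-adic unit**; `nonempty_ringHom_padic_two_of_root`;
  `exists_prime_two_ramificationIdx_inertiaDeg_eq_one_of_root` (a prime `v ∣ 2` of `F` with `e(v|2) = f(v|2) = 1`, att-p5 g26's dictionary).
* §2 ★★★ `crux_of_forall_dyadic_nonGalois_cubicField_narrowClassicalMu` — **«for every cubic number field `F` which is NOT Galois over `ℚ` and ADMITS A RING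
  MAP `F → ℚ₂`: (a) `μ₂ = 0` (growth form) for every cyclotomic `ℤ₂`-extension of `F` and (b) bounded narrow `2`-defect along them» + PRINT⁵ + MuIneqʳ ⟹
  `MainConjectureOfRankZeroBSDAtTwo` BY NAME.** Strictly fewer fields than g33's binder (e.g. every cubic field in which `2` is inert or totally ramified is
  dropped), same conclusion; `narrowMu_dyadic_of_narrowMu_nonGalois_cubic` records the (trivial) implication g33-binder ⟹ dyadic binder.
* §3 THE DYADIC SIGN-SPLIT and DISCRIMINANT-SIGN forms: `dyadicNarrowMu_iff_dyadicSignSplit` (W-free: one dyadic binder ⟺ «complex dyadic `S₃`-cubics: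
  `μ₂ = 0`» ∧ «totally real dyadic `S₃`-cubics: `μ₂ = 0` ∧ bounded narrow `2`-defect», the complex half carrying no narrow clause by
  `NarrowDefectBoundedOfClassicalMuOneRealPlace`); ★★ `crux_of_classicalMu_complexDyadicCubic_of_narrowClassicalMu_totallyRealDyadicCubic`;
  ★★ `crux_of_classicalMu_negDiscDyadicCubic_of_narrowClassicalMu_posDiscDyadicCubic` (textbook indexing: `d_F < 0` / `d_F > 0, d_F ∉ ℤ²`, plus `F ↪ ℚ₂`).
* §4 ★★ `pointFieldMuCyc_of_forall_dyadic_nonGalois_cubicField_narrowClassicalMu` — the REGISTERED STUB PFμ⁺ (`PointFieldMuCycAtTwo`, body verbatim) from the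
  dyadic input (for the v13 skeleton proposal `Lines/birth_v13_proposal_att_p4g34.lean`: road (b″) sorry-free MODULO {PRINT⁵, LimDoor, MuIneqʳ} + ONE
  named conjecture on the dyadic class).
* §5 (appended) `nonempty_ringHom_padic_two_iff_exists_prime` — W-free, any number field: `Nonempty (F →+* ℚ_[2])` ⟺ a prime above `2` with `e = f = 1`
  (att-p5 g26's per-prime dictionary globalised), so the dyadic binder may be keyed on `HeightOneSpectrum` data interchangeably.

RESTATEMENT MENU (D-0014), sharpened: the planner may file
`NarrowMuTwoOfDyadicNonCyclicCubic : Prop := ∀ (F : Type) [Field F] [NumberField F], Module.finrank ℚ F = 3 → ¬ IsGalois ℚ F → Nonempty (F →+* ℚ_[2]) →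
  (∀ κ : ZpExtension F 2, κ.IsCyclotomic → ClassicalMuVanishes κ) ∧ ∃ D, ∀ κ : ZpExtension F 2, κ.IsCyclotomic → ∀ n, ∀ [NumberField ↥(κ.layer n)],
  padicValNat 2 (narrowClassNumber ↥(κ.layer n)) ≤ padicValNat 2 (classNumber ↥(κ.layer n)) + D`
as ONE named conjecture [special case of Iwasawa's `μ = 0` conjecture (complex `F`) and of Greenberg's conjecture in Kida's narrow form (totally real `F`);
OPEN IN PRINT for non-abelian `F`; no printed (cyclic / Ferrero–Washington) case inside the binder] and restate C2 as the conditional bridge on it (closer: §2,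
one line). Expected REF2 grade: COROLLARY-OF-TREE. PARTITION: none; beyond-print theorem: no; BSD is NOT proved by any of this.

References: [Greenberg2001IwasawaPastPresent] §4; [Kida1982JFields] Thm. 1, Remark (ii); [Iwasawa1973MuInvariants] §3–§4; [NeukirchANT1999] Ch. II §8
(8.1)–(8.3) (primes ⟷ embeddings into `ℚ_p`); [SilvermanAEC2009] III.§1, VII.2 (reduction of `2`-torsion, the canonical subgroup at ordinary `2`);
[Kato2004Asterisque] Thm. 17.4, §17.13; [GreenbergLNM1716] Thm. 4.1, Conj. 1.11; tree: g33 `…NarrowCubicNamedInput{,SignSplit,Menu,DiscSign}`, att-p5 g11/g26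
`…KilfordStratum` / `…CubicPrimesOfEmbeddings`, att-p5 g14 `…AlignedTransportAtTwoBridge` (`exists_heightOneSpectrum_of_ringHom_padic`, `exists_powerBasis_gen_eq`),
`Literature/…/NarrowDefectBoundedOfClassicalMuOneRealPlace`, `Literature/…/CubicFields/CubicField{GaloisIffSquareDiscriminant,SignatureFromDiscriminant}`.
-/

-- the Theorems namespace of this sub repeats the summit name by design (D-0017 nested layout)
set_option linter.dupNamespace false
set_option autoImplicit false

noncomputable section

open scoped NumberField IntermediateField

namespace Summit.BirchSwinnertonDyer.BirchSwinnertonDyer.Theorems.AlignedTransportAtTwoNarrowCubicNamedInputDyadic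

open NumberField Polynomial WeierstrassCurve IntermediateField Field CongruenceSubgroup IsDedekindDomain
  Literature.NumberTheory.EllipticCurves Literature.NumberTheory.EllipticCurves.Greenberg1999
  Literature.NumberTheory.EllipticCurves.ModularForms Literature.NumberTheory.EllipticCurves.Rank1Residual
  Literature.NumberTheory.EllipticCurves.Module
  Literature.NumberTheory.EllipticCurves.DokchitserDokchitser2012
  Literature.NumberTheory.EllipticCurves.ZpExtension Literature.NumberTheory.GaloisRepresentations
  Literature.NumberTheory.IwasawaTheory Literature.NumberTheory.NumberFields Literature.NumberTheory.CubicFields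
  Summit.BirchSwinnertonDyer.Rank1Residual Summit.BirchSwinnertonDyer.Rank1Residual.X1.MuLambda
  Summit.BirchSwinnertonDyer.Rank1Residual.X5 Summit.BirchSwinnertonDyer.Rank1Residual.F1Sign2
  Summit.BirchSwinnertonDyer.BirchSwinnertonDyer.Theorems.Rank1ResidualX1Defs
  Summit.BirchSwinnertonDyer.BirchSwinnertonDyer.Theses.AlignedTransportAtTwo
  Summit.BirchSwinnertonDyer.BirchSwinnertonDyer.Theorems.AlignedTransportAtTwoFineRoad.DivisionCubic
  Summit.BirchSwinnertonDyer.BirchSwinnertonDyer.Theorems.AlignedTransportAtTwoPointFieldCarrierCM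
  Summit.BirchSwinnertonDyer.BirchSwinnertonDyer.Theorems.AlignedTransportAtTwoPointFieldCarrierCMIff
  Summit.BirchSwinnertonDyer.BirchSwinnertonDyer.Theorems.AlignedTransportAtTwoCMSexticFieldDoor
  Summit.BirchSwinnertonDyer.BirchSwinnertonDyer.Theorems.AlignedTransportAtTwoSharedCubicDivisionField
  Summit.BirchSwinnertonDyer.BirchSwinnertonDyer.Theorems.AlignedTransportAtTwoNarrowCubicNamedInput
  Summit.BirchSwinnertonDyer.BirchSwinnertonDyer.Theorems.AlignedTransportAtTwoNarrowCubicNamedInputSignSplit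
  Summit.BirchSwinnertonDyer.BirchSwinnertonDyer.Theorems.AlignedTransportAtTwoNarrowCubicNamedInputMenu
  Summit.BirchSwinnertonDyer.BirchSwinnertonDyer.Theorems.AlignedTransportAtTwoBridge
  Summit.BirchSwinnertonDyer.BirchSwinnertonDyer.Theorems.AlignedTransportAtTwoKilfordStratum
  Summit.BirchSwinnertonDyer.BirchSwinnertonDyer.Theorems.AlignedTransportAtTwoCubicPrimesOfEmbeddings

/-! ## §1 The cell's cubic `2`-torsion fields embed into `ℚ₂` -/

section Dyadic

variable (W : WeierstrassCurve ℚ) [W.IsElliptic] [W.IsGloballyMinimal]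

/-- **Good ORDINARY reduction at `2` ⟹ a `ℚ`-algebra map `F → ℚ₂` for every cubic number field `F` containing a root `e` of the `u`-cubic `c_W`,
sending `e` to an ODD `2`-ADIC UNIT** (`W` globally minimal, `W(ℚ)[2] = 0`): `c_W ≡ u²(u+1) (mod 2)` has the simple root `1`, which lifts (Hensel,
att-p5/att-p4 g11 `exists_padicInt_root_of_isOrdinaryAt_two`) to `y ∈ ℤ₂ˣ`; `F = ℚ(e)` with `minpoly e = c_W` (irreducible since `W(ℚ)[2] = 0`), and the
power basis on `e` lifts `e ↦ y`. (The point `(y/4, ·)` generates the canonical subgroup of `W[2]` at `2`.)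
[cite: SilvermanAEC2009, VII.2 (reduction of torsion; formal group)] [cite: NeukirchANT1999, Ch. II §8 (8.1)–(8.3)] -/
theorem exists_algHom_padic_two_of_root (hord : IsOrdinaryAt W 2) (ht : ∀ x : ℚ, ¬ HasRationalTwoTorsionX W x)
    {F : Type} [Field F] [NumberField F] (hF : Module.finrank ℚ F = 3) {e : F} (he : aeval e (twoDivisionUCubic W) = 0) :
    ∃ σ : F →ₐ[ℚ] ℚ_[2], ∃ y : ℤ_[2], ‖y‖ = 1 ∧ σ e = (y : ℚ_[2]) := by
  obtain ⟨y, hy1, hy⟩ := exists_padicInt_root_of_isOrdinaryAt_two W hord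
  have hmin : minpoly ℚ e = twoDivisionUCubic W := minpoly_eq_twoDivisionUCubic W ht he
  obtain ⟨pb, hgen, -⟩ := exists_powerBasis_gen_eq (natDegree_twoDivisionUCubic W) hF hmin
  have hroot : aeval (y : ℚ_[2]) (minpoly ℚ pb.gen) = 0 := by rw [hgen, hmin]; exact hy
  refine ⟨pb.lift (y : ℚ_[2]) hroot, y, hy1, ?_⟩
  rw [← hgen, PowerBasis.lift_gen]

/-- **The cell's cubic `2`-torsion fields EMBED INTO `ℚ₂`** (`W` globally minimal, good ordinary at `2`, `W(ℚ)[2] = 0`; W-free target: every cubic number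
field `F` containing a root of `c_W`). [cite: SilvermanAEC2009, VII.2] [cite: NeukirchANT1999, Ch. II §8 (8.1)–(8.3)] -/
theorem nonempty_ringHom_padic_two_of_root (hord : IsOrdinaryAt W 2) (ht : ∀ x : ℚ, ¬ HasRationalTwoTorsionX W x)
    {F : Type} [Field F] [NumberField F] (hF : Module.finrank ℚ F = 3) {e : F} (he : aeval e (twoDivisionUCubic W) = 0) :
    Nonempty (F →+* ℚ_[2]) := by
  obtain ⟨σ, -⟩ := exists_algHom_padic_two_of_root W hord ht hF he
  exact ⟨σ.toRingHom⟩

/-- **…hence have a prime above `2` of ramification index `1` and residue degree `1`** (att-p5 g26's dictionary «embedding `F → ℚ_p` ⟹ prime with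
`e = f = 1`», applied to §1's embedding): in particular `2` is NEITHER INERT NOR TOTALLY RAMIFIED in a cubic `2`-torsion field of the cell — the
good-supersingular signature `2 = 𝔭³` never occurs. [cite: NeukirchANT1999, Ch. II §8 (8.2)–(8.3) and Ch. I §8 Prop. (8.2)] [cite: SilvermanAEC2009, VII.2] -/
theorem exists_prime_two_ramificationIdx_inertiaDeg_eq_one_of_root (hord : IsOrdinaryAt W 2) (ht : ∀ x : ℚ, ¬ HasRationalTwoTorsionX W x)
    {F : Type} [Field F] [NumberField F] (hF : Module.finrank ℚ F = 3) {e : F} (he : aeval e (twoDivisionUCubic W) = 0) :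
    ∃ v : HeightOneSpectrum (𝓞 F), ((2 : ℕ) : 𝓞 F) ∈ v.asIdeal ∧ v.asIdeal.ramificationIdx ℤ = 1 ∧ v.asIdeal.inertiaDeg ℤ = 1 := by
  haveI : Fact (Nat.Prime 2) := ⟨Nat.prime_two⟩
  obtain ⟨σ, -⟩ := exists_algHom_padic_two_of_root W hord ht hF he
  obtain ⟨v, hv2, hv⟩ := exists_heightOneSpectrum_of_ringHom_padic (σ : F →+* ℚ_[2])
  have hv' : ∀ r : 𝓞 F, r ∈ v.asIdeal ↔ ‖(σ : F →+* ℚ_[2]) (algebraMap (𝓞 F) F r)‖ < 1 :=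
    mem_iff_norm_lt_one_of_valuation_iff (σ : F →+* ℚ_[2]) v hv
  exact ⟨v, hv2, ramificationIdx_eq_one_of_ringHom_padic (σ : F →+* ℚ_[2]) v hv',
    inertiaDeg_eq_one_of_ringHom_padic (σ : F →+* ℚ_[2]) v hv'⟩

/-- The model `ℚ⟮β₀⟯ ⊆ ℚ̄` of the cubic `2`-torsion field embeds into `ℚ₂` (`W` globally minimal, good ordinary at `2`, `W(ℚ)[2] = 0`).
[cite: SilvermanAEC2009, VII.2] [cite: NeukirchANT1999, Ch. II §8 (8.1)–(8.3)] -/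
theorem nonempty_ringHom_padic_two_adjoin_xT (hord : IsOrdinaryAt W 2) (ht : ∀ x : ℚ, ¬ HasRationalTwoTorsionX W x) :
    letI : FiniteDimensional ℚ ↥ℚ⟮xT W two_ne_zero 0⟯ :=
      adjoin.finiteDimensional ((AlgebraicClosure.isAlgebraic ℚ).isAlgebraic _).isIntegral
    letI : NumberField ↥ℚ⟮xT W two_ne_zero 0⟯ := NumberField.mk
    Nonempty (↥ℚ⟮xT W two_ne_zero 0⟯ →+* ℚ_[2]) := by
  set B : IntermediateField ℚ (AlgebraicClosure ℚ) := ℚ⟮xT W two_ne_zero 0⟯ with hB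
  haveI : FiniteDimensional ℚ ↥B := adjoin.finiteDimensional ((AlgebraicClosure.isAlgebraic ℚ).isAlgebraic _).isIntegral
  haveI : NumberField ↥B := NumberField.mk
  have h3 : Module.finrank ℚ ↥B = 3 := finrank_adjoin_xT_model W ht 0
  have h4mem : (4 : AlgebraicClosure ℚ) * xT W two_ne_zero 0 ∈ B := mul_mem (ofNat_mem B 4) (mem_adjoin_simple_self ℚ _)
  have he : aeval (⟨4 * xT W two_ne_zero 0, h4mem⟩ : ↥B) (twoDivisionUCubic W) = 0 :=
    aeval_mk_eq_zero_of_aeval_eq_zero W B (aeval_four_mul_xT_twoDivisionUCubic W 0) h4mem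
  exact nonempty_ringHom_padic_two_of_root W hord ht h3 he

end Dyadic

/-! ## §2 THE CRUX BY NAME from the DYADIC named input -/

section Cell

/-- ★★★ **«NARROW `μ₂⁺ = 0` FOR EVERY NON-CYCLIC CUBIC NUMBER FIELD THAT EMBEDS INTO `ℚ₂`» + PRINT⁵ + MuIneqʳ ⟹ C2 BY NAME.** Granted PRINT {Kato 17.4 (1)(2)
at `2` (every curve), Greenberg 4.1, period unit, modularity, GZK} and the registered stub MuIneqʳ (`hI`): IF for every cubic number field `F` which is not
Galois over `ℚ` and admits a ring map `F → ℚ₂`, (a) every cyclotomic `ℤ₂`-extension of `F` has `μ = 0` (growth form) and (b) for some `D` the narrow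
`2`-defect of every layer is at most `D`, THEN `MainConjectureOfRankZeroBSDAtTwo`. For each `W` the hypothesis is used once, on a cubic field `F ∋ e`,
`c_W(e) = 0` (not Galois by g33 §1; dyadic by §1 here); then g33's cell-restricted door. The hypothesis is [Iwasawa `μ₂` for complex dyadic `S₃`-cubics] ∧
[Greenberg–Kida narrow `μ₂⁺` for totally real dyadic `S₃`-cubics], OPEN IN PRINT; nothing is asserted about it. CONDITIONAL; the item stays open; BSD is NOT
proved. [cite: Greenberg2001IwasawaPastPresent, §4 (Iwasawa's μ = 0 conjecture)] [cite: Kida1982JFields, Thm. 1 (p. 340) and Remark (ii) (p. 341)]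
[cite: Kato2004Asterisque, Thm. 17.4 (p. 273) and §17.13 (pp. 279–280)] [cite: GreenbergLNM1716, Thm. 4.1 (p. 102) and Conj. 1.11 (p. 58)]
[cite: NeukirchANT1999, Ch. II §8 (8.1)–(8.3)] -/
theorem crux_of_forall_dyadic_nonGalois_cubicField_narrowClassicalMu
    (h17 : ∀ (V : WeierstrassCurve ℚ) [V.IsElliptic] [V.IsGloballyMinimal] [NeZero (V.conductorNorm ℤ)]
      (f : CuspForm (Gamma0 (V.conductorNorm ℤ)) 2), kato_divisibility_allPrimes V 2 (f := f))
    (hGr : Greenberg1999.thm41_charValue_rankZero_anyPrime)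
    (hper : realPeriodRat_eq_unit_mul_plusPeriod_two) (hmod : nonempty_modularParametrizationData)
    (hGZK : rank_eq_analyticRank_of_analyticRank_le_one)
    (hI : ∀ (W : WeierstrassCurve ℚ) [W.IsElliptic] [W.IsGloballyMinimal], IsOrdinaryAt W 2 →
      (∀ x : ℚ, ¬ HasRationalTwoTorsionX W x) →
      ∀ (κ : ZpExtension ℚ 2) (γ : Field.absoluteGaloisGroup ℚ), κ.IsCyclotomic →
      κ.IsTopGenerator γ → IsCyclotomicVariable 2 γ →
      ∀ ⦃N : ℕ⦄ [NeZero N] (f : CuspForm (Gamma0 N) 2), IsNewformOf W f →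
      ∀ Gp : IwasawaAlgebra 2, iwasawaToPowerSeries 2 Gp = padicLFunction f (unitRoot W 2 : ℚ_[2]) →
      ∀ (D : W.SelmerDualData κ γ) (Yr : W.FineSelmerDualDataRelaxedInf κ γ),
        lengthAt (IwasawaAlgebra 2) D.X ⟨IwasawaAlgebra.augIdealP 2, IwasawaAlgebra.isPrime_augIdealP_holds 2⟩ ≤
          lengthAt (IwasawaAlgebra 2) (IwasawaAlgebra 2 ⧸ Ideal.span {Gp})
              ⟨IwasawaAlgebra.augIdealP 2, IwasawaAlgebra.isPrime_augIdealP_holds 2⟩ +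
            lengthAt (IwasawaAlgebra 2) Yr.X ⟨IwasawaAlgebra.augIdealP 2, IwasawaAlgebra.isPrime_augIdealP_holds 2⟩)
    (hN : ∀ (F : Type) [Field F] [NumberField F], Module.finrank ℚ F = 3 → ¬ IsGalois ℚ F → Nonempty (F →+* ℚ_[2]) →
      (∀ κ : ZpExtension F 2, κ.IsCyclotomic → ClassicalMuVanishes κ) ∧
        ∃ D : ℕ, ∀ κ : ZpExtension F 2, κ.IsCyclotomic → ∀ n : ℕ, ∀ [NumberField ↥(κ.layer n)],
          padicValNat 2 (narrowClassNumber ↥(κ.layer n)) ≤ padicValNat 2 (classNumber ↥(κ.layer n)) + D) :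
    MainConjectureOfRankZeroBSDAtTwo :=
  crux_of_forall_cubicField_root_narrowClassicalMu h17 hGr hper hmod hGZK hI
    (fun W _ _ _ hord ht hsq _ _ F _ _ hF _ he ↦
      hN F hF (not_isGalois_of_root W ht hsq hF he) (nonempty_ringHom_padic_two_of_root W hord ht hF he))

/-- **g33's one binder ⟹ the dyadic binder** (trivial: forget the embedding). W-free bookkeeping for the skeleton: `NarrowMuNonCyclicCubicAtTwo` of v12 implies
the dyadic input of v13. [cite: Kida1982JFields, Remark (ii) (p. 341)] -/
theorem narrowMu_dyadic_of_narrowMu_nonGalois_cubic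
    (hN : ∀ (F : Type) [Field F] [NumberField F], Module.finrank ℚ F = 3 → ¬ IsGalois ℚ F →
      (∀ κ : ZpExtension F 2, κ.IsCyclotomic → ClassicalMuVanishes κ) ∧
        ∃ D : ℕ, ∀ κ : ZpExtension F 2, κ.IsCyclotomic → ∀ n : ℕ, ∀ [NumberField ↥(κ.layer n)],
          padicValNat 2 (narrowClassNumber ↥(κ.layer n)) ≤ padicValNat 2 (classNumber ↥(κ.layer n)) + D) :
    ∀ (F : Type) [Field F] [NumberField F], Module.finrank ℚ F = 3 → ¬ IsGalois ℚ F → Nonempty (F →+* ℚ_[2]) →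
      (∀ κ : ZpExtension F 2, κ.IsCyclotomic → ClassicalMuVanishes κ) ∧
        ∃ D : ℕ, ∀ κ : ZpExtension F 2, κ.IsCyclotomic → ∀ n : ℕ, ∀ [NumberField ↥(κ.layer n)],
          padicValNat 2 (narrowClassNumber ↥(κ.layer n)) ≤ padicValNat 2 (classNumber ↥(κ.layer n)) + D :=
  fun F _ _ hF hG _ ↦ hN F hF hG

end Cell

/-! ## §3 The dyadic SIGN-SPLIT and DISCRIMINANT-SIGN forms -/

section SignSplit

/-- ★★ **THE DYADIC ONE-BINDER INPUT ⟺ THE DYADIC SIGN-SPLIT PAIR** (W-free, kernel): «∀ cubic `F` not Galois over `ℚ` with `F ↪ ℚ₂`: `μ₂ = 0` for every cyclotomic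
`ℤ₂`-extension and bounded narrow `2`-defect» ⟺ «∀ such `F` NOT totally real: `μ₂ = 0`» ∧ «∀ such `F` totally real: `μ₂ = 0` and bounded narrow `2`-defect».
`⟸` on complex cubics is «one real place: `μ₂ = 0` ⟹ bounded narrow `2`-defect» (`NarrowDefectBoundedOfClassicalMuOneRealPlace`). Both sides are OPEN IN
PRINT; only their equivalence is asserted. [cite: Kida1982JFields, Thm. 1 (p. 340) and Remark (ii) (p. 341)] [cite: Iwasawa1973MuInvariants, Thm. 2 and Thm. 3, §3–§4] -/
theorem dyadicNarrowMu_iff_dyadicSignSplit :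
    (∀ (F : Type) [Field F] [NumberField F], Module.finrank ℚ F = 3 → ¬ IsGalois ℚ F → Nonempty (F →+* ℚ_[2]) →
      (∀ κ : ZpExtension F 2, κ.IsCyclotomic → ClassicalMuVanishes κ) ∧
        ∃ D : ℕ, ∀ κ : ZpExtension F 2, κ.IsCyclotomic → ∀ n : ℕ, ∀ [NumberField ↥(κ.layer n)],
          padicValNat 2 (narrowClassNumber ↥(κ.layer n)) ≤ padicValNat 2 (classNumber ↥(κ.layer n)) + D) ↔
    ((∀ (F : Type) [Field F] [NumberField F], Module.finrank ℚ F = 3 → ¬ IsGalois ℚ F → ¬ IsTotallyReal F → Nonempty (F →+* ℚ_[2]) →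
        ∀ κ : ZpExtension F 2, κ.IsCyclotomic → ClassicalMuVanishes κ) ∧
      ∀ (F : Type) [Field F] [NumberField F], Module.finrank ℚ F = 3 → ¬ IsGalois ℚ F → IsTotallyReal F → Nonempty (F →+* ℚ_[2]) →
        (∀ κ : ZpExtension F 2, κ.IsCyclotomic → ClassicalMuVanishes κ) ∧
          ∃ D : ℕ, ∀ κ : ZpExtension F 2, κ.IsCyclotomic → ∀ n : ℕ, ∀ [NumberField ↥(κ.layer n)],
            padicValNat 2 (narrowClassNumber ↥(κ.layer n)) ≤ padicValNat 2 (classNumber ↥(κ.layer n)) + D) := by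
  refine ⟨fun hN ↦ ⟨fun F _ _ hF hG _ hσ ↦ (hN F hF hG hσ).1, fun F _ _ hF hG _ hσ ↦ hN F hF hG hσ⟩, fun ⟨hC, hR⟩ F _ _ hF hG hσ ↦ ?_⟩
  by_cases hT : IsTotallyReal F
  · exact hR F hF hG hT hσ
  · have hμ := hC F hF hG hT hσ
    exact ⟨hμ, exists_narrowDefect_le_of_classicalMu_of_not_isTotallyReal_cubic F hF hT hμ⟩

/-- ★★ **(Iμ⁻_dy) «`μ₂ = 0` for every COMPLEX non-cyclic cubic field with `F ↪ ℚ₂`» ∧ (Gμ⁺_dy) «narrow `μ₂⁺ = 0` for every TOTALLY REAL non-cyclic cubic field with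
`F ↪ ℚ₂`» + PRINT⁵ + MuIneqʳ ⟹ C2 BY NAME** (REF2 g70's two labels — Iwasawa `μ₂` / Greenberg–Kida narrow `μ₂⁺` — restricted to the dyadic class; `Δ_W < 0`
members of the cell use the first, `Δ_W > 0` members the second). CONDITIONAL; nothing closed; BSD is NOT proved.
[cite: Iwasawa1973MuInvariants, Thm. 2 and Thm. 3, §3–§4] [cite: Kida1982JFields, Thm. 1 (p. 340) and Remark (ii) (p. 341)]
[cite: Kato2004Asterisque, Thm. 17.4 (p. 273) and §17.13 (pp. 279–280)] [cite: GreenbergLNM1716, Thm. 4.1 (p. 102) and Conj. 1.11 (p. 58)] -/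
theorem crux_of_classicalMu_complexDyadicCubic_of_narrowClassicalMu_totallyRealDyadicCubic
    (h17 : ∀ (V : WeierstrassCurve ℚ) [V.IsElliptic] [V.IsGloballyMinimal] [NeZero (V.conductorNorm ℤ)]
      (f : CuspForm (Gamma0 (V.conductorNorm ℤ)) 2), kato_divisibility_allPrimes V 2 (f := f))
    (hGr : Greenberg1999.thm41_charValue_rankZero_anyPrime)
    (hper : realPeriodRat_eq_unit_mul_plusPeriod_two) (hmod : nonempty_modularParametrizationData)
    (hGZK : rank_eq_analyticRank_of_analyticRank_le_one)
    (hI : ∀ (W : WeierstrassCurve ℚ) [W.IsElliptic] [W.IsGloballyMinimal], IsOrdinaryAt W 2 →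
      (∀ x : ℚ, ¬ HasRationalTwoTorsionX W x) →
      ∀ (κ : ZpExtension ℚ 2) (γ : Field.absoluteGaloisGroup ℚ), κ.IsCyclotomic →
      κ.IsTopGenerator γ → IsCyclotomicVariable 2 γ →
      ∀ ⦃N : ℕ⦄ [NeZero N] (f : CuspForm (Gamma0 N) 2), IsNewformOf W f →
      ∀ Gp : IwasawaAlgebra 2, iwasawaToPowerSeries 2 Gp = padicLFunction f (unitRoot W 2 : ℚ_[2]) →
      ∀ (D : W.SelmerDualData κ γ) (Yr : W.FineSelmerDualDataRelaxedInf κ γ),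
        lengthAt (IwasawaAlgebra 2) D.X ⟨IwasawaAlgebra.augIdealP 2, IwasawaAlgebra.isPrime_augIdealP_holds 2⟩ ≤
          lengthAt (IwasawaAlgebra 2) (IwasawaAlgebra 2 ⧸ Ideal.span {Gp})
              ⟨IwasawaAlgebra.augIdealP 2, IwasawaAlgebra.isPrime_augIdealP_holds 2⟩ +
            lengthAt (IwasawaAlgebra 2) Yr.X ⟨IwasawaAlgebra.augIdealP 2, IwasawaAlgebra.isPrime_augIdealP_holds 2⟩)
    (hC : ∀ (F : Type) [Field F] [NumberField F], Module.finrank ℚ F = 3 → ¬ IsGalois ℚ F → ¬ IsTotallyReal F → Nonempty (F →+* ℚ_[2]) →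
      ∀ κ : ZpExtension F 2, κ.IsCyclotomic → ClassicalMuVanishes κ)
    (hR : ∀ (F : Type) [Field F] [NumberField F], Module.finrank ℚ F = 3 → ¬ IsGalois ℚ F → IsTotallyReal F → Nonempty (F →+* ℚ_[2]) →
      (∀ κ : ZpExtension F 2, κ.IsCyclotomic → ClassicalMuVanishes κ) ∧
        ∃ D : ℕ, ∀ κ : ZpExtension F 2, κ.IsCyclotomic → ∀ n : ℕ, ∀ [NumberField ↥(κ.layer n)],
          padicValNat 2 (narrowClassNumber ↥(κ.layer n)) ≤ padicValNat 2 (classNumber ↥(κ.layer n)) + D) :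
    MainConjectureOfRankZeroBSDAtTwo :=
  crux_of_forall_dyadic_nonGalois_cubicField_narrowClassicalMu h17 hGr hper hmod hGZK hI (dyadicNarrowMu_iff_dyadicSignSplit.mpr ⟨hC, hR⟩)

/-- ★★ **THE DYADIC INPUT IN THE TEXTBOOK INDEXING**: (N⁻_dy) «for every cubic number field with `d_F < 0` and `F ↪ ℚ₂`: `μ₂ = 0` for every cyclotomic
`ℤ₂`-extension» ∧ (N⁺_dy) «for every cubic number field with `d_F > 0`, `d_F ∉ ℤ²` and `F ↪ ℚ₂`: `μ₂ = 0` and bounded narrow `2`-defect» + PRINT⁵ + MuIneqʳ ⟹ C2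
BY NAME (Brill: totally real ⟺ `d_F > 0` for cubics; Galois ⟺ `d_F ∈ ℤ²`). CONDITIONAL; nothing closed; BSD is NOT proved.
[cite: Cohen1993, Prop. 4.8.11 (Brill) and §6.3.3] [cite: Kida1982JFields, Thm. 1 (p. 340) and Remark (ii) (p. 341)]
[cite: Kato2004Asterisque, Thm. 17.4 (p. 273) and §17.13 (pp. 279–280)] [cite: GreenbergLNM1716, Thm. 4.1 (p. 102) and Conj. 1.11 (p. 58)] -/
theorem crux_of_classicalMu_negDiscDyadicCubic_of_narrowClassicalMu_posDiscDyadicCubic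
    (h17 : ∀ (V : WeierstrassCurve ℚ) [V.IsElliptic] [V.IsGloballyMinimal] [NeZero (V.conductorNorm ℤ)]
      (f : CuspForm (Gamma0 (V.conductorNorm ℤ)) 2), kato_divisibility_allPrimes V 2 (f := f))
    (hGr : Greenberg1999.thm41_charValue_rankZero_anyPrime)
    (hper : realPeriodRat_eq_unit_mul_plusPeriod_two) (hmod : nonempty_modularParametrizationData)
    (hGZK : rank_eq_analyticRank_of_analyticRank_le_one)
    (hI : ∀ (W : WeierstrassCurve ℚ) [W.IsElliptic] [W.IsGloballyMinimal], IsOrdinaryAt W 2 →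
      (∀ x : ℚ, ¬ HasRationalTwoTorsionX W x) →
      ∀ (κ : ZpExtension ℚ 2) (γ : Field.absoluteGaloisGroup ℚ), κ.IsCyclotomic →
      κ.IsTopGenerator γ → IsCyclotomicVariable 2 γ →
      ∀ ⦃N : ℕ⦄ [NeZero N] (f : CuspForm (Gamma0 N) 2), IsNewformOf W f →
      ∀ Gp : IwasawaAlgebra 2, iwasawaToPowerSeries 2 Gp = padicLFunction f (unitRoot W 2 : ℚ_[2]) →
      ∀ (D : W.SelmerDualData κ γ) (Yr : W.FineSelmerDualDataRelaxedInf κ γ),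
        lengthAt (IwasawaAlgebra 2) D.X ⟨IwasawaAlgebra.augIdealP 2, IwasawaAlgebra.isPrime_augIdealP_holds 2⟩ ≤
          lengthAt (IwasawaAlgebra 2) (IwasawaAlgebra 2 ⧸ Ideal.span {Gp})
              ⟨IwasawaAlgebra.augIdealP 2, IwasawaAlgebra.isPrime_augIdealP_holds 2⟩ +
            lengthAt (IwasawaAlgebra 2) Yr.X ⟨IwasawaAlgebra.augIdealP 2, IwasawaAlgebra.isPrime_augIdealP_holds 2⟩)
    (hNeg : ∀ (F : Type) [Field F] [NumberField F], Module.finrank ℚ F = 3 → discr F < 0 → Nonempty (F →+* ℚ_[2]) →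
      ∀ κ : ZpExtension F 2, κ.IsCyclotomic → ClassicalMuVanishes κ)
    (hPos : ∀ (F : Type) [Field F] [NumberField F], Module.finrank ℚ F = 3 → 0 < discr F → ¬ IsSquare (discr F) → Nonempty (F →+* ℚ_[2]) →
      (∀ κ : ZpExtension F 2, κ.IsCyclotomic → ClassicalMuVanishes κ) ∧
        ∃ D : ℕ, ∀ κ : ZpExtension F 2, κ.IsCyclotomic → ∀ n : ℕ, ∀ [NumberField ↥(κ.layer n)],
          padicValNat 2 (narrowClassNumber ↥(κ.layer n)) ≤ padicValNat 2 (classNumber ↥(κ.layer n)) + D) :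
    MainConjectureOfRankZeroBSDAtTwo := by
  refine crux_of_classicalMu_complexDyadicCubic_of_narrowClassicalMu_totallyRealDyadicCubic h17 hGr hper hmod hGZK hI
    (fun F _ _ hF _ hT hσ ↦ hNeg F hF ((not_isTotallyReal_iff_discr_neg_of_finrank_eq_three F hF).mp hT) hσ)
    (fun F _ _ hF hG hT hσ ↦ hPos F hF ((isTotallyReal_iff_discr_pos_of_finrank_eq_three F hF).mp hT)
      (not_isSquare_discr_of_not_isGalois_cubic F hF hG) hσ)

end SignSplit

/-! ## §4 The registered stub PFμ⁺ from the dyadic input -/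

section Stub

/-- ★★ **THE REGISTERED STUB PFμ⁺ (`PointFieldMuCycAtTwo`, body verbatim) FROM THE DYADIC NAMED INPUT.** «∀ non-Galois cubic `F` with `F ↪ ℚ₂`: `μ₂(F^cyc) = 0` ∧
bounded narrow `2`-defect» ⟹ for every seed-cell `W` (binders of the stub verbatim) and every `i² = −1`: `μ₂ = 0` for every cyclotomic `ℤ₂`-extension of
`ℚ(W[2]) ⊔ ℚ⟮i⟯`. (On the model `ℚ⟮β₀⟯`: not Galois (g33 §1), dyadic (§1 here), odd degree; cell `bsd-2adic`'s Kida-lite ascent to `ℚ⟮β₀⟯ ⊔ ℚ⟮i⟯`; att-p3 g34's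
ascent `ℚ(β₀, i) → ℚ(W[2], i)`.) With this the v13 skeleton (road (b″): P, LimDoor, MuIneqʳ, PFμ⁺ ⟹ T ⟹ C2) is sorry-free MODULO {P = PRINT⁵, LimDoor = PRINT,
MuIneqʳ = PRINT-pending-typing} and ONE named conjecture on the DYADIC class. CONDITIONAL; nothing closed; BSD is NOT proved.
[cite: Kida1982JFields, Thm. 1 (p. 340)] [cite: Iwasawa1973MuInvariants, Thm. 2 and Thm. 3, §3–§4] [cite: Greenberg2001IwasawaPastPresent, §4] -/
theorem pointFieldMuCyc_of_forall_dyadic_nonGalois_cubicField_narrowClassicalMu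
    (hN : ∀ (F : Type) [Field F] [NumberField F], Module.finrank ℚ F = 3 → ¬ IsGalois ℚ F → Nonempty (F →+* ℚ_[2]) →
      (∀ κ : ZpExtension F 2, κ.IsCyclotomic → ClassicalMuVanishes κ) ∧
        ∃ D : ℕ, ∀ κ : ZpExtension F 2, κ.IsCyclotomic → ∀ n : ℕ, ∀ [NumberField ↥(κ.layer n)],
          padicValNat 2 (narrowClassNumber ↥(κ.layer n)) ≤ padicValNat 2 (classNumber ↥(κ.layer n)) + D) :
    ∀ (W : WeierstrassCurve ℚ) [W.IsElliptic] [W.IsGloballyMinimal], ¬ W.HasCM →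
      IsOrdinaryAt W 2 → (∀ x : ℚ, ¬ HasRationalTwoTorsionX W x) → ¬ IsSquare W.Δ →
      W.analyticRank = 0 → BSDp W 2 →
      ∀ i : AlgebraicClosure ℚ, i ^ 2 = -1 →
      ∀ κL : ZpExtension ↥(W.divisionField 2 ⊔ IntermediateField.adjoin ℚ {i}) 2,
        κL.IsCyclotomic → ClassicalMuVanishes κL := by
  intro W _ _ _ hord ht hsq _ _ i hi κL hκL
  set B : IntermediateField ℚ (AlgebraicClosure ℚ) := ℚ⟮xT W two_ne_zero 0⟯ with hB
  haveI : FiniteDimensional ℚ ↥B := adjoin.finiteDimensional ((AlgebraicClosure.isAlgebraic ℚ).isAlgebraic _).isIntegral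
  haveI : NumberField ↥B := NumberField.mk
  have h3 : Module.finrank ℚ ↥B = 3 := finrank_adjoin_xT_model W ht 0
  obtain ⟨hμ, D, hδ⟩ := hN ↥B h3 (not_isGalois_adjoin_xT W ht hsq 0) (nonempty_ringHom_padic_two_adjoin_xT W hord ht)
  have hodd : Odd (Module.finrank ℚ ↥B) := by rw [h3]; decide
  have hP : ∀ κP : ZpExtension ↥(B ⊔ IntermediateField.adjoin ℚ ({i} : Set (AlgebraicClosure ℚ))) 2,
      κP.IsCyclotomic → ClassicalMuVanishes κP :=
    classicalMu_sup_adjoin_of_sq_eq_neg_one_of_narrowDefect_le B hodd hi hμ D hδ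
  exact (classicalMuVanishes_sup_adjoin_I_iff_pointFieldCM_of_isOrdinaryAt W hord ht hsq hi 0).mpr hP κL hκL

end Stub

/-! ## §5 (appended, same gen) The dyadic class in the tree's prime currency -/

section PrimeCurrency

/-- **«`F` embeds into `ℚ₂`» ⟺ «`F` has a prime above `2` with `e = f = 1`»** — W-free, for ANY number field `F` (att-p5 g26's per-prime dictionary
`…CubicPrimesOfEmbeddings.exists_ringHom_padic_iff` / `…CubicOffStratumPrimes.exists_ringHom_padic_of_ramificationIdx_eq_one_of_inertiaDeg_eq_one`
globalised): the planner may key the dyadic named input on `Nonempty (F →+* ℚ_[2])` or on `HeightOneSpectrum` data interchangeably.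
[cite: NeukirchANT1999, Ch. II §8, (8.1)–(8.3)] -/
theorem nonempty_ringHom_padic_two_iff_exists_prime (F : Type) [Field F] [NumberField F] :
    Nonempty (F →+* ℚ_[2]) ↔
      ∃ v : HeightOneSpectrum (𝓞 F), ((2 : ℕ) : 𝓞 F) ∈ v.asIdeal ∧ v.asIdeal.ramificationIdx ℤ = 1 ∧ v.asIdeal.inertiaDeg ℤ = 1 := by
  haveI : Fact (Nat.Prime 2) := ⟨Nat.prime_two⟩
  constructor
  · rintro ⟨σ⟩
    obtain ⟨v, hv2, hv⟩ := exists_heightOneSpectrum_of_ringHom_padic σ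
    have hv' : ∀ r : 𝓞 F, r ∈ v.asIdeal ↔ ‖σ (algebraMap (𝓞 F) F r)‖ < 1 := mem_iff_norm_lt_one_of_valuation_iff σ v hv
    exact ⟨v, hv2, ramificationIdx_eq_one_of_ringHom_padic σ v hv', inertiaDeg_eq_one_of_ringHom_padic σ v hv'⟩
  · rintro ⟨v, hv2, he, hf⟩
    obtain ⟨σ, -⟩ :=
      Summit.BirchSwinnertonDyer.BirchSwinnertonDyer.Theorems.AlignedTransportAtTwoCubicOffStratumPrimes.exists_ringHom_padic_of_ramificationIdx_eq_one_of_inertiaDeg_eq_one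
        (p := 2) v hv2 he hf
    exact ⟨σ⟩

end PrimeCurrency

end Summit.BirchSwinnertonDyer.BirchSwinnertonDyer.Theorems.AlignedTransportAtTwoNarrowCubicNamedInputDyadic

end
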